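import Summits.HodgeConjecture.CorCM.AbelianTwoPowerSubgroupInduction
import Literature.AlgebraicGeometry.Pohlmann1968.NondegenerateCMTypeHodgeConjecture
import HarnessLib

/-!
# Kubota-rank certificates for CM types of a Galois CM field, read on a concrete model of its Galois group

COR-CM (cell `pub-hodgecm2`), binder seat b04 (gen 16), count-neutral claim GALOIS16-NONAB (sequel of gen 11's
`CyclotomicRankCertificates`, which reads types of CYCLOTOMIC fields on unit residues).  KERNEL ONLY: theorems; no
definition, no named fact, no `sorry`.  `HC_CM` is neither used nor claimed.

SETTING.  `K/ℚ` Galois CM with an isomorphism `e : Gal(K/ℚ) ≃ G₀` onto a concrete finite group (possibly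
NON-ABELIAN), base embedding `φ₀`, embeddings `σ_g = φ₀ ∘ g⁻¹`; a CM type `Φ` is read on `G₀` as
`S = {y | σ_{e⁻¹ y} ∈ Φ}`.  `Aut(ℂ)` acts on the embeddings through RIGHT translations (`τ ∘ φ₀ = φ₀ ∘ γ` gives
`τ σ_g = σ_{g γ⁻¹}`), so the Kubota–Dodson rank `cmTypeRank Φ` is the rank of the matrix `[y · g ∈ S]_{g, y}`.

* §1 **`le_cmTypeRank_of_galoisCert`**: translates `g_i` and evaluation points `x_j` in `G₀` with an INTEGER
  QUASI-INVERSE `M`, `Σ_j [x_j g_i ∈ S] M_{jk} = D δ_{ik}`, `D ≠ 0`, certify `r ≤ cmTypeRank Φ`;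
  **`isNondegenerate_of_galoisCert`** (`r = [K:ℚ]/2 + 1`).
* §2 **`not_isPrimitive_of_leftStabiliser`**: a left stabiliser `v ≠ 1` of `S` makes `Φ` imprimitive.
* §3 **`isNondegenerate_of_isPrimitive_of_census`**: a census over ALL CM sets of `(G₀, c₀)` — each keyed either by
  a left stabiliser or by a right translate carrying a certificate from a table — read back at the `Prop` level:
  every primitive CM type of `K` is nondegenerate; with the Hodge-conjecture consumers for simple realisations.

All hypotheses of §3 are decidable statements about finite data (`decide` at the use site, part IIIb-style files).

## References

* [Dodson1987] B. Dodson, J. Algebra 111 (1987), §1.1 p. 50 (`Rank(Φ)`).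
* [Kubota1965] T. Kubota, Trans. AMS 118 (1965), §2 p. 115, Lemma 2.
* [Shimura1998] G. Shimura, *Abelian Varieties with Complex Multiplication and Modular Functions*, §8.1, §8.2 Prop. 26.
* [Gordon1999HodgeAVSurvey] B. B. Gordon, *A survey of the Hodge conjecture for abelian varieties*, Thm. 6.4.
-/

noncomputable section

open CategoryTheory CategoryTheory.Limits NumberField
open scoped BigOperators

namespace Summit.HodgeConjecture.CorCM.GaloisRank

open Literature.NumberTheory.ComplexMultiplication
open Literature.AlgebraicGeometry.Motives (AbelianVariety CMType)
open Literature.AlgebraicGeometry.HodgeTheory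
open Literature.AlgebraicGeometry.ComplexMultiplication (IsCMTypeRealisation isSimple_iff_isPrimitive)
open Literature.AlgebraicGeometry.Pohlmann1968
open Literature.Barriers.HodgeConjecture (divisorClassesSpan)
open Summit.HodgeConjecture.CorCM.ThinKernel (not_isPrimitive_of_forall_mem_iff)

open scoped Classical

variable {K : Type} [Field K] [NumberField K] [IsCMField K]
variable {G₀ : Type*} [Group G₀] [Fintype G₀] [DecidableEq G₀]

/-! ## §1 Certificates -/

omit [IsCMField K] [Fintype G₀] in
/-- **A certified nonsingular minor of the right-translate matrix gives `r ≤ Rank(Φ)`.**  `K/ℚ` Galois CM,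
`e : Gal(K/ℚ) ≃ G₀`, `S = {y | σ_{e⁻¹y} ∈ Φ}`; `g, x : Fin r → G₀`, `M` an integer matrix and `D ≠ 0` with
`Σ_j [x_j g_i ∈ S] M_{jk} = D δ_{ik}`.  Then the `r` translates `τ_i Φ` (`τ_i ∘ φ₀ = φ₀ ∘ e⁻¹(g_i⁻¹)`, so that
`τ_i σ_{e⁻¹ y} = σ_{e⁻¹(y g_i)}`) are linearly independent: `r ≤ cmTypeRank Φ`. [cite: Dodson1987, §1.1 (p. 50)] -/
theorem le_cmTypeRank_of_galoisCert [IsGalois ℚ K] (e : (K ≃ₐ[ℚ] K) ≃* G₀) (Φ : CMType K) (φ₀ : K →+* ℂ)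
    (S : Finset G₀) (hS : ∀ y : G₀, y ∈ S ↔ embOf φ₀ (e.symm y) ∈ Φ.1) {r : ℕ} (g x : Fin r → G₀)
    (M : Fin r → Fin r → ℤ) (D : ℤ) (hD : D ≠ 0)
    (hcert : ∀ i k : Fin r, (∑ j : Fin r, if x j * g i ∈ S then M j k else 0) = if i = k then D else 0) :
    r ≤ cmTypeRank Φ := by
  -- the translates `τ_i`
  choose τ hτ using fun i : Fin r => exists_ringEquiv_comp_eq_algEquiv φ₀ (e.symm (g i)⁻¹)
  have hsmul : ∀ (i : Fin r) (y : G₀), τ i • embOf φ₀ (e.symm y) = embOf φ₀ (e.symm (y * g i)) := by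
    intro i y
    rw [smul_embOf_of_comp φ₀ (hτ i), map_inv, inv_inv, ← map_mul]
  let f : Fin r → (K →+* ℂ) → ℚ := fun i => translateInd Φ.1 (τ i)
  have hval : ∀ i j, f i (embOf φ₀ (e.symm (x j))) = if x j * g i ∈ S then (1 : ℚ) else 0 := fun i j => by
    show translateInd Φ.1 (τ i) _ = _
    by_cases h : x j * g i ∈ S
    · rw [if_pos h, translateInd_of_mem (by rw [hsmul]; exact (hS _).1 h)]
    · rw [if_neg h, translateInd_of_not_mem (by rw [hsmul]; exact fun h' => h ((hS _).2 h'))]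
  have hpair : ∀ i k : Fin r, ∑ j, f i (embOf φ₀ (e.symm (x j))) * (M j k : ℚ) =
      if i = k then (D : ℚ) else 0 := fun i k => by
    have h1 : ∀ j, f i (embOf φ₀ (e.symm (x j))) * (M j k : ℚ) =
        ((if x j * g i ∈ S then M j k else 0 : ℤ) : ℚ) := fun j => by
      rw [hval]; split_ifs <;> simp
    simp_rw [h1]
    rw [← Int.cast_sum, hcert i k]
    split_ifs <;> simp
  have hli : LinearIndependent ℚ f := by
    rw [Fintype.linearIndependent_iff]
    intro a ha k
    have heval : ∀ j, ∑ i, a i * f i (embOf φ₀ (e.symm (x j))) = 0 := fun j => by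
      have := congrFun ha (embOf φ₀ (e.symm (x j)))
      simpa only [Finset.sum_apply, Pi.smul_apply, smul_eq_mul, Pi.zero_apply] using this
    have h0 : ∑ j, (M j k : ℚ) * ∑ i, a i * f i (embOf φ₀ (e.symm (x j))) = 0 := by simp [heval]
    have h1 : ∑ j, (M j k : ℚ) * ∑ i, a i * f i (embOf φ₀ (e.symm (x j))) =
        ∑ i, a i * ∑ j, f i (embOf φ₀ (e.symm (x j))) * (M j k : ℚ) := by
      simp_rw [Finset.mul_sum]; rw [Finset.sum_comm]
      exact Finset.sum_congr rfl fun i _ => Finset.sum_congr rfl fun j _ => by ring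
    rw [h1] at h0; simp_rw [hpair] at h0
    have h2 : a k * (D : ℚ) = 0 := by simpa [mul_ite, Finset.sum_ite_eq'] using h0
    exact (mul_eq_zero.1 h2).resolve_right (Int.cast_ne_zero.2 hD)
  have h1 : Module.finrank ℚ (Submodule.span ℚ (Set.range f)) = r := by
    rw [finrank_span_eq_card hli, Fintype.card_fin]
  have h3 := Submodule.finrank_mono (Submodule.span_mono (R := ℚ) (M := (K →+* ℂ) → ℚ)
    (s := Set.range f) (t := Set.range fun γ : ℂ ≃+* ℂ => translateInd Φ.1 γ)
    (by rintro _ ⟨i, rfl⟩; exact ⟨τ i, rfl⟩))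
  rw [h1] at h3
  exact h3

omit [Fintype G₀] in
/-- **Certificate of full rank ⟹ nondegenerate** (`cmTypeRank Φ = [K:ℚ]/2 + 1`). [cite: Dodson1987, §1.1 (p. 50)] -/
theorem isNondegenerate_of_galoisCert [IsGalois ℚ K] (e : (K ≃ₐ[ℚ] K) ≃* G₀) (Φ : CMType K) (φ₀ : K →+* ℂ)
    (S : Finset G₀) (hS : ∀ y : G₀, y ∈ S ↔ embOf φ₀ (e.symm y) ∈ Φ.1) {r : ℕ}
    (hr : r = Module.finrank ℚ K / 2 + 1) (g x : Fin r → G₀) (M : Fin r → Fin r → ℤ) (D : ℤ) (hD : D ≠ 0)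
    (hcert : ∀ i k : Fin r, (∑ j : Fin r, if x j * g i ∈ S then M j k else 0) = if i = k then D else 0) :
    IsNondegenerate Φ := by
  rw [isNondegenerate_iff]
  exact le_antisymm (cmTypeRank_le Φ) (hr ▸ le_cmTypeRank_of_galoisCert e Φ φ₀ S hS g x M D hD hcert)

/-! ## §2 Left stabilisers -/

omit [IsCMField K] [Fintype G₀] [DecidableEq G₀] in
/-- **A left stabiliser `v ≠ 1` of `S` makes `Φ` imprimitive** (the `Aut(ℂ)`-translates, acting by right
translation, do not separate `σ_1` from `σ_{e⁻¹ v}`). [cite: Shimura1998, §8.2 Prop. 26] -/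
theorem not_isPrimitive_of_leftStabiliser [Normal ℚ K] (e : (K ≃ₐ[ℚ] K) ≃* G₀) (Φ : CMType K) (φ₀ : K →+* ℂ)
    (S : Finset G₀) (hS : ∀ y : G₀, y ∈ S ↔ embOf φ₀ (e.symm y) ∈ Φ.1) {v : G₀} (hv1 : v ≠ 1)
    (hv : ∀ w : G₀, w ∈ S ↔ v * w ∈ S) : ¬ IsPrimitive (ℂ ≃+* ℂ) Φ.1 φ₀ := by
  refine not_isPrimitive_of_forall_mem_iff Φ φ₀ (v := e.symm v) (fun h => hv1 ?_) fun z => ?_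
  · rw [← e.apply_symm_apply v, h, map_one]
  · have h := hv (e z)
    rw [hS, hS, map_mul, e.symm_apply_apply] at h
    exact h

/-! ## §3 Census soundness -/

omit [IsCMField K] in
/-- Every sign pattern on `Fin m` is the bit pattern of some `b < 2^m`. [folklore] -/
theorem exists_testBit_eq : ∀ (m : ℕ) (ε : Fin m → Bool), ∃ b : ℕ, b < 2 ^ m ∧ ∀ i : Fin m, b.testBit i = ε i
  | 0, ε => ⟨0, by norm_num, fun i => i.elim0⟩
  | m + 1, ε => by
    obtain ⟨b, hb, hbit⟩ := exists_testBit_eq m (fun i => ε i.succ)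
    refine ⟨Nat.bit (ε 0) b, ?_, fun i => ?_⟩
    · rw [Nat.bit_val, pow_succ]; cases ε 0 <;> simp <;> omega
    · refine Fin.cases ?_ (fun j => ?_) i
      · exact Nat.testBit_bit_zero _ _
      · rw [Fin.val_succ, Nat.testBit_bit_succ, hbit]

/-- **Census over all CM sets of `(G₀, c₀)`, read back.**  Data: `c₀ = e(c)`; a transversal `R : Fin m → G₀` of
`{y, c₀ y}` (`2m = [K:ℚ]`; every `y` is some `R i` or `c₀ R i`); CM sets encoded by `b < 2^m` as
`S_b = {R l | bit_l b} ∪ {c₀ R l | ¬ bit_l b}`; representatives `reps : Fin q → Finset G₀` each with a CERTIFICATE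
(`hcert`); and hint functions of `b` selecting either a left stabiliser `stabOf b ≠ 1` of `S_b` or a right
translation with `S_b = reps (repOf b) · δOf b` (`hcover`).  Then every PRIMITIVE CM type of `K` is NONDEGENERATE.
Both `hcert` and `hcover` are decidable statements about finite data. [cite: Dodson1987, §1.1 (p. 50)]
[cite: Shimura1998, §8.2 Prop. 26] -/
theorem isNondegenerate_of_isPrimitive_of_census [IsGalois ℚ K] (e : (K ≃ₐ[ℚ] K) ≃* G₀) (c₀ : G₀)
    (hc : e ((IsCMField.complexConj K).restrictScalars ℚ) = c₀) {m : ℕ} (hm : Module.finrank ℚ K = 2 * m)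
    (R : Fin m → G₀) (hR : ∀ y : G₀, ∃ i, y = R i ∨ y = c₀ * R i) {r : ℕ} (hr : r = m + 1) {q : ℕ}
    (reps : Fin q → Finset G₀) (g x : Fin q → Fin r → G₀) (M : Fin q → Fin r → Fin r → ℤ) (D : Fin q → ℤ)
    (hcert : ∀ a : Fin q, D a ≠ 0 ∧ ∀ i k : Fin r,
      (∑ j : Fin r, if x a j * g a i ∈ reps a then M a j k else 0) = if i = k then D a else 0)
    (sel : ℕ → Bool) (stabOf δOf : ℕ → G₀) (repOf : ℕ → Fin q)
    (hcover : ∀ b : ℕ, b < 2 ^ m →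
      (sel b = true ∧ stabOf b ≠ 1 ∧ ∀ w : G₀,
        (∃ l : Fin m, (b.testBit l = true ∧ w = R l) ∨ (b.testBit l = false ∧ w = c₀ * R l)) ↔
        (∃ l : Fin m, (b.testBit l = true ∧ stabOf b * w = R l) ∨
          (b.testBit l = false ∧ stabOf b * w = c₀ * R l))) ∨
      (sel b = false ∧ ∀ w : G₀,
        (∃ l : Fin m, (b.testBit l = true ∧ w = R l) ∨ (b.testBit l = false ∧ w = c₀ * R l)) ↔
        w * (δOf b)⁻¹ ∈ reps (repOf b)))
    {Φ : CMType K} (φ₀ : K →+* ℂ) (hprim : IsPrimitive (ℂ ≃+* ℂ) Φ.1 φ₀) : IsNondegenerate Φ := by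
  set c : K ≃ₐ[ℚ] K := (IsCMField.complexConj K).restrictScalars ℚ with hc_def
  -- the CM set read on `G₀`
  set S : Finset G₀ := Finset.univ.filter fun y => embOf φ₀ (e.symm y) ∈ Φ.1 with hS_def
  have hS : ∀ y : G₀, y ∈ S ↔ embOf φ₀ (e.symm y) ∈ Φ.1 := fun y => by
    simp only [hS_def, Finset.mem_filter, Finset.mem_univ, true_and]
  have hc' : e.symm c₀ = c := by rw [← hc, e.symm_apply_apply]
  have hScm : ∀ y : G₀, c₀ * y ∈ S ↔ y ∉ S := fun y => by
    rw [hS, hS, map_mul, hc']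
    exact Summit.HodgeConjecture.CorCM.GaloisOctic.embOf_complexConj_mul_mem_iff Φ φ₀ _
  -- its sign pattern on the transversal, as a number `b₀ < 2^m`
  obtain ⟨b₀, hb₀, hbit⟩ := exists_testBit_eq m (fun i => decide (R i ∈ S))
  have hkey : ∀ w : G₀, (∃ l : Fin m, (b₀.testBit l = true ∧ w = R l) ∨
      (b₀.testBit l = false ∧ w = c₀ * R l)) ↔ w ∈ S := by
    intro w
    simp_rw [hbit]
    constructor
    · rintro ⟨i, (⟨hi, rfl⟩ | ⟨hi, rfl⟩)⟩
      · simpa using hi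
      · have hi' : R i ∉ S := by simpa using hi
        by_contra h
        exact hi' (by_contra fun h' => h ((hScm (R i)).2 h'))
    · intro hw
      obtain ⟨i, (rfl | rfl)⟩ := hR w
      · exact ⟨i, Or.inl ⟨by simpa using hw, rfl⟩⟩
      · exact ⟨i, Or.inr ⟨by simpa using (hScm (R i)).1 hw, rfl⟩⟩
  rcases hcover b₀ hb₀ with ⟨-, hv1, hv⟩ | ⟨-, hrep⟩
  · -- a left stabiliser contradicts primitivity
    exfalso
    refine not_isPrimitive_of_leftStabiliser e Φ φ₀ S hS hv1 (fun w => ?_) hprim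
    rw [← hkey w, ← hkey (stabOf b₀ * w)]
    exact hv w
  · -- `S = rep · δ`: the certificate of `rep`, translated
    obtain ⟨hD, hce⟩ := hcert (repOf b₀)
    refine isNondegenerate_of_galoisCert e Φ φ₀ S hS (r := r) (by rw [hr, hm]; omega)
      (fun i => g (repOf b₀) i * δOf b₀) (x (repOf b₀)) (M (repOf b₀)) (D (repOf b₀)) hD fun i k => ?_
    rw [← hce i k]
    refine Finset.sum_congr rfl fun j _ => ?_
    have hiff : x (repOf b₀) j * (g (repOf b₀) i * δOf b₀) ∈ S ↔
        x (repOf b₀) j * g (repOf b₀) i ∈ reps (repOf b₀) := by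
      rw [← hkey, hrep, ← mul_assoc, mul_inv_cancel_right]
    by_cases h : x (repOf b₀) j * g (repOf b₀) i ∈ reps (repOf b₀)
    · rw [if_pos h, if_pos (hiff.2 h)]
    · rw [if_neg h, if_neg (fun h' => h (hiff.1 h'))]

/-! ## §4 Consumers -/

section Geometry

variable [IsGalois ℚ K]
variable {Φ : CMType K} {A : AbelianVariety ℂ} {ι : 𝓞 K →+* End A}
  {θ : K →+* Module.End ℂ (complexBetti A.X 1)}

/-- **The Hodge conjecture for every power of a SIMPLE realisation, from a census** (`A` simple ⟺ `Φ` primitive;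
nondegenerate ⟹ `Hdg = Div` on all powers, Hazama/Gordon 6.4). [cite: Gordon1999HodgeAVSurvey, 5.13 (i) and Thm. 6.4]
[cite: Shimura1998, §8.2 Prop. 26] -/
theorem hodgeConjectureFor_pow_of_isSimple_of_census (e : (K ≃ₐ[ℚ] K) ≃* G₀) (c₀ : G₀)
    (hc : e ((IsCMField.complexConj K).restrictScalars ℚ) = c₀) {m : ℕ} (hm : Module.finrank ℚ K = 2 * m)
    (R : Fin m → G₀) (hR : ∀ y : G₀, ∃ i, y = R i ∨ y = c₀ * R i) {r : ℕ} (hr : r = m + 1) {q : ℕ}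
    (reps : Fin q → Finset G₀) (g x : Fin q → Fin r → G₀) (M : Fin q → Fin r → Fin r → ℤ) (D : Fin q → ℤ)
    (hcert : ∀ a : Fin q, D a ≠ 0 ∧ ∀ i k : Fin r,
      (∑ j : Fin r, if x a j * g a i ∈ reps a then M a j k else 0) = if i = k then D a else 0)
    (sel : ℕ → Bool) (stabOf δOf : ℕ → G₀) (repOf : ℕ → Fin q)
    (hcover : ∀ b : ℕ, b < 2 ^ m →
      (sel b = true ∧ stabOf b ≠ 1 ∧ ∀ w : G₀,
        (∃ l : Fin m, (b.testBit l = true ∧ w = R l) ∨ (b.testBit l = false ∧ w = c₀ * R l)) ↔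
        (∃ l : Fin m, (b.testBit l = true ∧ stabOf b * w = R l) ∨
          (b.testBit l = false ∧ stabOf b * w = c₀ * R l))) ∨
      (sel b = false ∧ ∀ w : G₀,
        (∃ l : Fin m, (b.testBit l = true ∧ w = R l) ∨ (b.testBit l = false ∧ w = c₀ * R l)) ↔
        w * (δOf b)⁻¹ ∈ reps (repOf b)))
    (hA : IsCMTypeRealisation Φ A ι θ) (hs : A.IsSimple) (N : ℕ) :
    HodgeConjectureFor (⨁ fun _ : Fin N => A).dim (⨁ fun _ : Fin N => A).X := by
  obtain ⟨φ₀⟩ := (inferInstance : Nonempty (K →+* ℂ))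
  exact (isNondegenerate_of_isPrimitive_of_census e c₀ hc hm R hR hr reps g x M D hcert sel stabOf δOf repOf
    hcover φ₀ ((isSimple_iff_isPrimitive hA φ₀).1 hs)).hodgeConjectureFor_pow hA N

end Geometry

end Summit.HodgeConjecture.CorCM.GaloisRank

end
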